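import Summits.ABC.IUTFork.Cor312Steps
import Summits.ABC.IUTFork.Cor312Statement
import Summits.ABC.IUTFork.Cor312RemarksToy
import HarnessLib

/-!
# [IUTchIII] Corollary 3.12, proof Substeps (xi-a)–(xi-c), over the real definitions (TEAM A, row A-2)

Record-only file (D-0012) of the abc-iut cell (Cor. 3.12 strategy TEAM A «direct III§3», seat
abc-iut-c312-10 = A2; row **A-2** of `HOME/plan/C312-TEAMS.md`); TAKES NO SIDE. Companion to
`Cor312StepXReal.lean` (row A-1): it discharges the proof nodes **(xi-a), (xi-b), (xi-c)** of
[IUTchIII] Cor. 3.12 (kurims text `paper:url-4b091feeb646`, p. 181 l. 33 – p. 182 l. 46;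
`Cor312Proof.Step.xi_a/xi_b/xi_c`) as kernel inferences over the frozen definitions — real readings for
their six observations, the kernel lemmas behind each, and the `Step.Holds` wirings.

The observations (quotes ibid., read on this seat's render) and their readings over the verbatim setting
`P : Cor312.Setting S` (c312-7, fields frozen) and a `ThetaLinkStrips` datum `D` (L6-t4, Def. 3.8 (ii)):

* `Obs.linkAsGluing` ((xi-a), p. 181 l. 37–44: "the Θ^{×μ}_{LGP}-link from `(0,0)` to `(1,0)` may be
  interpreted as a sort of **gluing isomorphism** … in such a way that the Θ-pilot object at `(0,0)` …
  corresponds to the q-pilot object at `(1,0)`"). Reading `StepXI.LinkAsGluing P D VG`: the value-group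
  correspondence `VG` (the content of Step (i)'s `Obs.valueGroupMapsPilots`, which (xi-a) invokes —
  parameterised here, owner row A-5) AND, at every lattice position, the horizontal arrow (the full
  poly-isomorphism `thetaLGPLink`, L6-t4) is NONEMPTY — a gluing isomorphism exists. The nonemptiness is
  the one real hypothesis (`hNE` of `stepXIa_holds`): Def. 3.8 (ii) presupposes the strips are abstractly
  isomorphic; the real-instance discharge is L6-t2's «iso_nonempty_of_model» lemmas (KummerPrimeStrips /
  strip-category files), consumed there, never re-proved here. The intended instantiation of `VG` is
  c312-1's object-level `PilotLink` (`Thm311ToCor312.lean`, p411317 lane; its (xi-b) column-equivalence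
  `possibleImages_eq_of_multiradialCompat` likewise covers the `^{0,∘}𝒰 ⥲ ^{1,∘}𝒰` clause this file
  deliberately does not restate).
* `Obs.valueGroupLinkFullPolyIso` ((xi-b), p. 182 l. 2–7: "the `𝓕^⊩▶`-prime-strip portion of the
  link/relationship … consists precisely of **(full poly-)isomorphisms** of `𝓕^⊩▶`-prime-strips").
  Reading `StepXI.ValueGroupFullPoly`, PROVED OUTRIGHT (`valueGroupFullPoly_holds`): in the landed typing
  the Θ^{×μ}_{LGP}-link IS the full poly-isomorphism — `thetaLGPLink … = Set.univ`, c312-8's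
  `Cor312Rmk.bitw_link_eq_univ` (rfl). TAUTOLOGICAL AS TYPED, and recorded as such: this is the place
  where the cell's negatives of record (skel `ForkStrips` abstract-link vacuity; LANA Rem. 8.2.1;
  `displayXIe_of_abstractLink_reading`) show the ∃-isomorphism reading carries no information singling
  out the q-pilot — per the team's no-inflation rule the reading states exactly what the frozen
  definition makes true, no more.
* `Obs.outputSatisfiesIPLSHE` ((xi-b), p. 181 l. 45–56: the algorithm "yields a construction of a
  collection of possibilities of output data … that satisfies the **input prime-strip link (IPL)** and
  **simultaneous holomorphic expressibility (SHE)** properties"). Reading `StepXI.OutputIPLSHE CIPL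
  CSHE` := `CIPL ∧ CSHE`, parameterised over the contents of the cited LOCI `IPL`, `SHE` (Rmk. 3.11.1
  (iii), (iv) — "not typable as printed" per the skel's standing note, LANA Rem. 8.2.1; the step ASSERTS
  the output satisfies what those loci define, so the honest reading is the pass-through conjunction).
* `Obs.onlyQualitative` ((xi-b), p. 182 l. 8–24: "we shall **only be concerned** with qualitative
  logical aspects/consequences of this construction algorithm, i.e., with the (IPL), (SHE), (APT)
  properties … "temporarily forgetting" [(HIS)] … the fact that the … algorithm … involves Θ-pilot
  objects, theta functions/values, mono-theta environments"). Reading `StepXI.OnlyQualitative`, PROVED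
  OUTRIGHT by `decide` over the landed citation DAG (`xi_cdef_cites_qualitative`): the downstream
  substeps (xi-c)–(xi-f) cite the algorithm only through `thm3_11_algo`/`IPL`/`SHE` and the volume/hull
  remark loci — never through `etTh` or a Thm 3.11 (i)/(ii)/(iii) sub-item locus (checked for the landed
  `Step.cites` AND the ref-corrected `Step.cites'`). The printed "temporarily forgetting" is thus a
  kernel-checkable property of the printed proof's own citation structure.
* `Obs.displayXIc` ((xi-c), p. 182 l. 25–35: the displayed summary — output possibilities "linked/related
  [cf. (IPL)], via isomorphisms of `𝓕^⊩▶`-prime-strips, to the representation … of the q-pilot object at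
  `(1,0)` on `^{1,∘}𝒰^Q`", construction "expressed entirely relative to the arithmetic holomorphic
  structure in the 1-column [cf. (SHE)]"). Reading `StepXI.DisplayXIc` := the conjunction of the two
  invoked (xi-b) observations' contents with the full-poly-iso fact — the display is the step's own
  summary of (IPL) ∧ (SHE), so the reading is their pass-through packaged with `ValueGroupFullPoly`.
* `Obs.hullGivesVectorBundles` ((xi-c), p. 182 l. 36–46: "by slightly enlarging … by working with the
  **holomorphic hull** … we obtain output data … in terms of **localizations of arithmetic vector
  bundles** … [isomorphs of `𝒪_{K_v}`] … necessary in order to render the output data in a form that is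
  **comparable** to the representation of the q-pilot object"). Reading `StepXI.HullComparable`, PROVED
  OUTRIGHT (`hullComparable_holds`): wherever the hull is defined, `thetaHull` is a HULL-SET
  (`λ·𝒪`-form — the typed "localization of an arithmetic vector bundle", `HullFrame.hull_mem_of_hasHull`)
  and the q-pilot image is a hull-set (the frozen field `qRegion_mem`, Rmk. 3.9.5 (ix) (cQ3)) — the two
  quantities are read on the SAME class of regions, which is the typed form of "comparable".

`Cor312Proof.stepXIa_holds` / `stepXIb_holds` / `stepXIc_holds` then prove `Step.xi_a/xi_b/xi_c |>.Holds
L O` for any reading wired to these contents (pointwise hypotheses, as in A-1). Note (xi-b) invokes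
A-1's `Obs.kummerDetachmentInd123` and the opening paragraph's `Obs.restrictToStrips`; neither is needed
for the three conclusions as read, and the wirings quantify over them untouched.

Sources read on the page (this seat's renders, `folder/.lit/texts/paper-url-4b091feeb646/`): pp. 181–182.
[claim: Mochizuki2012, status: disputed] Deliberately NOT here: Step (x) (A-1, landed p411096 lane),
(xi-d)–(xi-e) (row A-3), the (xi-f) edge and GapA (row A-4, lead), the real-instance nonemptiness of the
strip isomorphisms (L6-t2), the loci contents `IPL`/`SHE` themselves (c312-2 locus resolution / dag);
any judgement.
-/

noncomputable section

open Set

namespace Summit.ABC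

namespace IUTFork

namespace StepXI

open Thm311 Literature.IUT.LogThetaLattice

variable {T : ThetaIndex} {S : Situation T} (P : Cor312.Setting S)

/-! ## 1. (xi-a): the link as a gluing -/

/-- READING of `Obs.linkAsGluing` ((xi-a), p. 181 l. 37–44), over a `ThetaLinkStrips` datum `D` for the
setting's strips and a proposition `VG` standing for the content of Step (i)'s
`Obs.valueGroupMapsPilots` (owner row A-5; (xi-a) invokes that observation): the value-group
correspondence holds, and at every position of the LGP-Gaussian log-theta-lattice the horizontal arrow —
the full poly-isomorphism `thetaLGPLink` relative to the vertical log-link below its domain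
(Def. 3.8 (ii), (iii)) — is nonempty, i.e. a gluing isomorphism exists. [claim: Mochizuki2012,
status: disputed] -/
@[claim "Mochizuki2012" "disputed"] def LinkAsGluing (D : ThetaLinkStrips P.LogLink P.Strip)
    (VG : Prop) : Prop :=
  VG ∧ ∀ n m : ℤ,
    (thetaLGPLink (Iso := P.IsoS) D (P.lattice.logLink n (m - 1))
      (P.lattice.theater (n + 1) m)).Nonempty

/-- The nonemptiness clause of `LinkAsGluing` is equivalent to the abstract isomorphism existence for the
strips at each position (the full poly-isomorphism is `Set.univ`, c312-8 `Cor312Rmk.bitw_link_eq_univ`;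
its nonemptiness is `Nonempty (IsoS … …)` — Def. 3.8 (ii)'s presupposition, discharged at the real
instances by L6-t2's strip-category «iso_nonempty_of_model» lemmas). [folklore] -/
theorem linkAsGluing_nonempty_iff (D : ThetaLinkStrips P.LogLink P.Strip) (n m : ℤ) :
    (thetaLGPLink (Iso := P.IsoS) D (P.lattice.logLink n (m - 1))
        (P.lattice.theater (n + 1) m)).Nonempty ↔
      Nonempty (P.IsoS (D.stripLGP (P.lattice.logLink n (m - 1)))
        (D.stripDelta (P.lattice.theater (n + 1) m))) := by
  rw [Cor312Rmk.bitw_link_eq_univ]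
  exact ⟨fun ⟨φ, _⟩ => ⟨φ⟩, fun ⟨φ⟩ => ⟨φ, Set.mem_univ φ⟩⟩

/-! ## 2. (xi-b): the value-group portion is the full poly-isomorphism; (IPL)/(SHE); (HIS) -/

/-- READING of `Obs.valueGroupLinkFullPolyIso` ((xi-b), p. 182 l. 2–7): the `𝓕^⊩▶`-portion of the link
"consists precisely of (full poly-)isomorphisms" — in the landed typing, the Θ^{×μ}_{LGP}-link at every
lattice position IS `Set.univ`. TAUTOLOGICAL AS TYPED (see the module docstring: the cell's negatives of
record show the ∃-isomorphism reading is vacuous; this def records exactly what the frozen definition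
makes true). [claim: Mochizuki2012, status: disputed] -/
@[claim "Mochizuki2012" "disputed"] def ValueGroupFullPoly
    (D : ThetaLinkStrips P.LogLink P.Strip) : Prop :=
  ∀ n m : ℤ,
    thetaLGPLink (Iso := P.IsoS) D (P.lattice.logLink n (m - 1)) (P.lattice.theater (n + 1) m) =
      Set.univ

/-- `ValueGroupFullPoly` holds outright: the link is the full poly-isomorphism by definition
(c312-8 `Cor312Rmk.bitw_link_eq_univ`, rfl on the landed L6-t4 `thetaLGPLink`). [folklore] -/
theorem valueGroupFullPoly_holds (D : ThetaLinkStrips P.LogLink P.Strip) :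
    ValueGroupFullPoly P D :=
  fun _n _m => Cor312Rmk.bitw_link_eq_univ D _ _

/-- READING of `Obs.outputSatisfiesIPLSHE` ((xi-b), p. 181 l. 45–56): the pass-through conjunction of
the contents `CIPL`, `CSHE` of the cited loci `IPL`, `SHE` (Rmk. 3.11.1 (iii), (iv); parameters — the
loci are "not typable as printed" (LANA Rem. 8.2.1, skel standing note) and their resolution is
c312-2's locus table; the step asserts the algorithm's output satisfies them).
[claim: Mochizuki2012, status: disputed] -/
@[claim "Mochizuki2012" "disputed"] def OutputIPLSHE (CIPL CSHE : Prop) : Prop := CIPL ∧ CSHE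

/-- The qualitative loci: the algorithm cited only as "some algorithm" (`thm3_11_algo`), its qualitative
properties (`IPL`, `SHE`, `APT`, `HIS`), and the volume/hull/remark loci of the estimate — no `etTh`, no
Thm 3.11 (i)/(ii)/(iii) sub-item. [claim: Mochizuki2012, status: disputed] -/
def qualitativeLoci : List Cor312Proof.Locus :=
  [.thm3_11_algo, .IPL, .SHE, .APT, .HIS, .rem3_9_5_vii, .rem3_9_5_viii, .rem3_9_5_ix, .rem3_9_5_x,
    .prop3_9_iii, .rem3_9_2, .rem3_9_6, .rem1_5_2, .rem3_10_1, .rem3_12_2_v]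

/-- READING of `Obs.onlyQualitative` ((xi-b), p. 182 l. 8–24, (HIS) "temporarily forgetting"): the
downstream substeps (xi-c), (xi-d), (xi-e), (xi-f) cite only qualitative loci — a property of the
printed proof's own citation structure. [claim: Mochizuki2012, status: disputed] -/
@[claim "Mochizuki2012" "disputed"] def OnlyQualitative : Prop :=
  ∀ s ∈ [Cor312Proof.Step.xi_c, .xi_d, .xi_e, .xi_f], ∀ c ∈ s.cites, c ∈ qualitativeLoci

/-- `OnlyQualitative` holds outright, by `decide` over the landed citation DAG: (xi-c)–(xi-f) never cite
`etTh` or a Thm 3.11 sub-item locus — the kernel form of "temporarily forgetting … theta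
functions/values, mono-theta environments". [folklore] -/
theorem onlyQualitative_holds : OnlyQualitative := by
  unfold OnlyQualitative
  decide

/-- The same for the ref-corrected citation datum `Step.cites'` (PASS-R7 F5: (xi-c) also carries
`thm3_11_algo`): still only qualitative loci. [folklore] -/
theorem onlyQualitative_holds_cites' :
    ∀ s ∈ [Cor312Proof.Step.xi_c, .xi_d, .xi_e, .xi_f], ∀ c ∈ s.cites', c ∈ qualitativeLoci := by
  decide

/-! ## 3. (xi-c): the display, and comparability through the hull -/

/-- READING of `Obs.displayXIc` ((xi-c), p. 182 l. 25–35): the displayed summary packages the two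
invoked (xi-b) observations — output possibilities linked via (full poly-)isomorphisms of
`𝓕^⊩▶`-prime-strips [(IPL)] and expressible in the 1-column [(SHE)] — so its reading is their
pass-through conjunction together with the full-poly-iso fact for the setting's strips.
[claim: Mochizuki2012, status: disputed] -/
@[claim "Mochizuki2012" "disputed"] def DisplayXIc (D : ThetaLinkStrips P.LogLink P.Strip)
    (CIPL CSHE : Prop) : Prop :=
  OutputIPLSHE CIPL CSHE ∧ ValueGroupFullPoly P D

/-- READING of `Obs.hullGivesVectorBundles` ((xi-c), p. 182 l. 36–46): wherever the union of possible
images admits its holomorphic hull, that hull is a HULL-SET `λ·𝒪_{(−)}` — the typed "localization of an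
arithmetic vector bundle" — and the q-pilot image is a hull-set (frozen field `qRegion_mem`, Rmk. 3.9.5
(ix) (cQ3)): both printed quantities are read on the same class of regions ("comparable").
[claim: Mochizuki2012, status: disputed] -/
@[claim "Mochizuki2012" "disputed"] def HullComparable : Prop :=
  ∀ (j : T.Label) (vQ : T.VQ), P.HullDefined j vQ →
    P.thetaHull j vQ ∈ (P.frame j vQ).Hul ∧ P.qRegionOf P.qPilot j vQ ∈ (P.frame j vQ).Hul

/-- `HullComparable` holds outright over the frozen setting (`HullFrame.hull_mem_of_hasHull` +
`qRegion_mem`). [folklore] -/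
theorem hullComparable_holds : HullComparable P := fun j vQ hHD =>
  ⟨(P.frame j vQ).hull_mem_of_hasHull hHD.1 hHD.2, P.qRegion_mem j vQ⟩

end StepXI

/-! ## 4. The three substeps as inferences -/

namespace Cor312Proof

open StepXI Thm311 Literature.IUT.LogThetaLattice

variable {T : ThetaIndex} {S : Situation T} (P : Cor312.Setting S)

/-- **(xi-a) HOLDS** under any reading wired to `LinkAsGluing`: from the invoked Step (i) observation
(`O .valueGroupMapsPilots → VG`) and the strip-isomorphism nonemptiness (`hNE` — Def. 3.8 (ii)'s
presupposition, L6-t2's real-instance lemmas), the gluing observation follows.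
[claim: Mochizuki2012, status: disputed] -/
theorem stepXIa_holds (D : ThetaLinkStrips P.LogLink P.Strip) {L : Locus → Prop} {O : Obs → Prop}
    {VG : Prop} (hVG : O .valueGroupMapsPilots → VG)
    (hNE : ∀ n m : ℤ, Nonempty (P.IsoS (D.stripLGP (P.lattice.logLink n (m - 1)))
      (D.stripDelta (P.lattice.theater (n + 1) m))))
    (hO : LinkAsGluing P D VG → O .linkAsGluing) : Step.xi_a.Holds L O := by
  intro _hc hu o ho
  have ho' : o = Obs.linkAsGluing := by simpa [Step.concl, Step.data] using ho
  subst ho'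
  refine hO ⟨hVG (hu _ (by decide)), fun n m => ?_⟩
  exact (linkAsGluing_nonempty_iff P D n m).2 (hNE n m)

/-- **(xi-b) HOLDS** under any reading wired to the three contents: `OutputIPLSHE` from the cited loci
`IPL`, `SHE`; `ValueGroupFullPoly` and `OnlyQualitative` outright. The invoked observations
(`kummerDetachmentInd123` of (x), `restrictToStrips` of the opening paragraph) are not needed for the
conclusions as read. [claim: Mochizuki2012, status: disputed] -/
theorem stepXIb_holds (D : ThetaLinkStrips P.LogLink P.Strip) {L : Locus → Prop} {O : Obs → Prop}
    {CIPL CSHE : Prop} (hIPL : L .IPL → CIPL) (hSHE : L .SHE → CSHE)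
    (hO1 : OutputIPLSHE CIPL CSHE → O .outputSatisfiesIPLSHE)
    (hO2 : ValueGroupFullPoly P D → O .valueGroupLinkFullPolyIso)
    (hO3 : OnlyQualitative → O .onlyQualitative) : Step.xi_b.Holds L O := by
  intro hc _hu o ho
  have ho' : o = Obs.outputSatisfiesIPLSHE ∨ o = Obs.valueGroupLinkFullPolyIso ∨
      o = Obs.onlyQualitative := by simpa [Step.concl, Step.data] using ho
  rcases ho' with rfl | rfl | rfl
  · exact hO1 ⟨hIPL (hc _ (by decide)), hSHE (hc _ (by decide))⟩
  · exact hO2 (valueGroupFullPoly_holds P D)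
  · exact hO3 onlyQualitative_holds

/-- **(xi-c) HOLDS** under any reading wired to the two contents: `DisplayXIc` packages the invoked
(xi-b) observations (pass-through) with the full-poly-iso fact; `HullComparable` outright.
[claim: Mochizuki2012, status: disputed] -/
theorem stepXIc_holds (D : ThetaLinkStrips P.LogLink P.Strip) {L : Locus → Prop} {O : Obs → Prop}
    {CIPL CSHE : Prop} (hIPL : O .outputSatisfiesIPLSHE → OutputIPLSHE CIPL CSHE)
    (hO1 : DisplayXIc P D CIPL CSHE → O .displayXIc)
    (hO2 : HullComparable P → O .hullGivesVectorBundles) : Step.xi_c.Holds L O := by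
  intro _hc hu o ho
  have ho' : o = Obs.displayXIc ∨ o = Obs.hullGivesVectorBundles := by
    simpa [Step.concl, Step.data] using ho
  rcases ho' with rfl | rfl
  · exact hO1 ⟨hIPL (hu _ (by decide)), valueGroupFullPoly_holds P D⟩
  · exact hO2 (hullComparable_holds P)

end Cor312Proof

end IUTFork

end Summit.ABC

end
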